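import Literature.AlgebraicGeometry.AbelianSchemes.AbelianSchemeOverBase
import HarnessLib

/-!
# Restriction of sections of an abelian scheme to a fibre is a group homomorphism `X(S) → X_s(Ω)`

Cell hodgecm-mathlib, `B-plan/M1PRIME-DAG.md` §5 D1 owed item «`restrictPt` multiplicativity» (B-plan1
2026-08-28T22:41:11Z / 23:04:50Z; placement B-typ01 23:05:13Z: a separate theorems-only file importing the carrier
`AbelianSchemeOverBase.lean`); writer B-p04 (by-paste certificate over D1 v4 383774a92334b2c7 =
`B-provers/B-p04/AbelianSchemeOverRestrictPtMul.bypaste-D1v4.B-p04g13.lean`).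

[MumfordFogartyKirwan1994, Ch. 7 §1, Definition 7.1 (p. 129)] speaks of «the images `σᵢ(s)`» of the basis sections in
«the group of points of order `n` on `X̄_s`» and of `Σ aᵢσᵢ(s)`: restriction to the fibre is tacitly a homomorphism
`X(S) → X_s(Ω)`.  In the carrier (`AbelianSchemeOverBase.lean`), `A.restrictPt s σ : AlgPoints (A.fibre s).X Ω` is the
`Ω`-point `(s ≫ σ, 𝟙)` of `A ×_S Spec Ω`, and the group law on
`AlgPoints (A.fibre s).X Ω = (specOver Ω Ω ⟶ (Over.pullback s).obj A.X)` is Mathlib's `Hom.group` for the TRANSPORTED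
group object `Functor.grpObjObj` (`fibre_X`, `baseChange_grpObj`).  The proof: `σ(s) = (toUnit ≫ ε) ≫ (Over.pullback s).map σ`
for the unit `ε` of the cartesian-monoidal functor `Over.pullback s` (`restrictPt_eq_toUnit_comp_map`, by
`pullback.hom_ext`), and `(Over.pullback s).map` is multiplicative (Mathlib `Functor.map_mul` / `map_one` /
`map_inv'`), pre-composition too (`MonObj.comp_mul`).

* `restrictPt_mul`, `restrictPt_one`, `restrictPt_inv`, `restrictPt_pow`, `restrictPt_zpow`, `restrictPt_pow_eq_one`,
  `restrictPt_list_prod`;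
* `restrictPt_sectionPow` — Mumford's `Σ aᵢ σᵢ(s)`: the shape in which D1's `LevelStructure.basis_injective/_surjective`
  clauses and D3's `lift_level` are read in `X_s[n](Ω)`;
* `restrict_left`, `restrictPt_eq_restrictPt_iff` — dictionary with the `FibrePoints` currency `A.restrict s`.

Theorems only (0 def / 0 fact / 0 instance); Mathlib + the carrier.  HC_CM is proved only modulo the 7 printed
citations until rung 0 closes; this file discharges none of them.

## References
* [MumfordFogartyKirwan1994] D. Mumford, J. Fogarty, F. Kirwan, *Geometric Invariant Theory*, 3rd ed., Ergebnisse
  **34**, Springer (1994) — Ch. 7 §1 Definition 7.1 (p. 129), §2 Definition 7.3 (p. 130).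
* Mathlib: `CategoryTheory.Monoidal.Cartesian.Over` (`Over.pullback` cartesian-monoidal, `ε_pullback_left`),
  `CategoryTheory.Monoidal.Cartesian.Mon` / `.Grp` (`Hom.group`, `Functor.map_mul`, `Functor.map_inv'`,
  `MonObj.comp_mul`, `GrpObj.comp_inv`).
-/

universe u

open CategoryTheory CategoryTheory.Limits AlgebraicGeometry MonoidalCategory

noncomputable section

namespace Literature.AlgebraicGeometry.AbelianSchemes

namespace AbelianSchemeOver

open scoped MonObj CategoryTheory.Obj

variable {S : Scheme.{u}} (A : AbelianSchemeOver S) {Ω : Type u} [Field Ω] (s : Spec (.of Ω) ⟶ S)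

/-- The underlying morphism of `σ(s)` in the `FibrePoints` currency is `s ≫ σ` (by construction:
`(toUnit (Over.mk s)).left = s`). [cite: MumfordFogartyKirwan1994, Ch. 7 §1 Definition 7.1 (p. 129)] -/
theorem restrict_left (σ : A.Sections) : (A.restrict s σ).left = s ≫ σ.left := rfl

/-- **`σ(s)` through the base-change functor**: the `Ω`-point `σ(s)` of the fibre `A_s` is the composite of the
canonical point `Spec Ω → (𝟙_S)_s = S ×_S Spec Ω` (the unit `ε` of the cartesian-monoidal functor `Over.pullback s`
after `toUnit`) with `(Over.pullback s).map σ : (𝟙_S)_s → A_s` — i.e. `σ(s) = σ ×_S Spec Ω` read at the unique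
`Ω`-point of `Spec Ω` (Mumford's `σᵢ ×_S T`, [MumfordFogartyKirwan1994, Def. 7.3]).  Proof by `pullback.hom_ext` on
`A ×_S Spec Ω`. [cite: MumfordFogartyKirwan1994, Ch. 7 §1 Definition 7.1 (p. 129) and §2 Definition 7.3 (p. 130)] -/
theorem restrictPt_eq_toUnit_comp_map (σ : A.Sections) :
    A.restrictPt s σ =
      CartesianMonoidalCategory.toUnit (Literature.AlgebraicGeometry.Motives.specOver Ω Ω) ≫
        Functor.LaxMonoidal.ε (Over.pullback s) ≫ (Over.pullback s).map σ := by
  -- the canonical point `Spec Ω → (𝟙_S)_s = S ×_S Spec Ω` followed by the second projection is the identity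
  have h23 : (CartesianMonoidalCategory.toUnit (Literature.AlgebraicGeometry.Motives.specOver Ω Ω)).left ≫
      (Functor.LaxMonoidal.ε (Over.pullback s)).left ≫ pullback.snd (𝟙_ (Over S)).hom s = 𝟙 (Spec (.of Ω)) := by
    have hε : (Functor.LaxMonoidal.ε (Over.pullback s)).left ≫ pullback.snd (𝟙_ (Over S)).hom s = 𝟙 _ :=
      Over.w (Functor.LaxMonoidal.ε (Over.pullback s))
    have ht : (CartesianMonoidalCategory.toUnit (Literature.AlgebraicGeometry.Motives.specOver Ω Ω)).left =
        𝟙 (Spec (.of Ω)) := by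
      change Spec.map (CommRingCat.ofHom (algebraMap Ω Ω)) = _
      rw [Algebra.algebraMap_self, CommRingCat.ofHom_id, Spec.map_id]
    rw [hε, ht]
    exact Category.comp_id _
  have h23' : ∀ {Z : Scheme.{u}} (h : Spec (.of Ω) ⟶ Z),
      (CartesianMonoidalCategory.toUnit (Literature.AlgebraicGeometry.Motives.specOver Ω Ω)).left ≫
        (Functor.LaxMonoidal.ε (Over.pullback s)).left ≫ pullback.snd (𝟙_ (Over S)).hom s ≫ h = h :=
    fun h =>
      calc (CartesianMonoidalCategory.toUnit (Literature.AlgebraicGeometry.Motives.specOver Ω Ω)).left ≫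
            (Functor.LaxMonoidal.ε (Over.pullback s)).left ≫ pullback.snd (𝟙_ (Over S)).hom s ≫ h
          = ((CartesianMonoidalCategory.toUnit (Literature.AlgebraicGeometry.Motives.specOver Ω Ω)).left ≫
              (Functor.LaxMonoidal.ε (Over.pullback s)).left ≫ pullback.snd (𝟙_ (Over S)).hom s) ≫ h := by
            simp only [Category.assoc]
        _ = h := by rw [h23]; exact Category.id_comp _
  -- over `S`, the first projection `S ×_S Spec Ω → S` is the second one followed by `s`
  have h1 : pullback.fst (𝟙_ (Over S)).hom s = pullback.snd (𝟙_ (Over S)).hom s ≫ s :=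
    (Category.comp_id _).symm.trans pullback.condition
  have h1' : pullback.fst (𝟙_ (Over S)).hom s ≫ σ.left = pullback.snd (𝟙_ (Over S)).hom s ≫ s ≫ σ.left := by
    rw [← Category.assoc]
    exact congrArg (· ≫ σ.left) h1
  -- the two projections of `(Over.pullback s).map σ = σ ×_S Spec Ω`
  have hc : ((Over.pullback s).map σ).left ≫ pullback.fst A.X.hom s =
      pullback.fst (𝟙_ (Over S)).hom s ≫ σ.left := by
    simp only [Over.pullback_map_left]
    erw [pullback.lift_fst]
  have hc' : ((Over.pullback s).map σ).left ≫ pullback.snd A.X.hom s = pullback.snd (𝟙_ (Over S)).hom s := by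
    simp only [Over.pullback_map_left]
    erw [pullback.lift_snd]
  -- the two projections of (the underlying morphism of) the right-hand side
  have hfst : (CartesianMonoidalCategory.toUnit (Literature.AlgebraicGeometry.Motives.specOver Ω Ω) ≫
      Functor.LaxMonoidal.ε (Over.pullback s) ≫ (Over.pullback s).map σ).left ≫ pullback.fst A.X.hom s =
        s ≫ σ.left := by
    rw [Over.comp_left, Over.comp_left, Category.assoc, Category.assoc, hc, h1']
    exact h23' _
  have hsnd : (CartesianMonoidalCategory.toUnit (Literature.AlgebraicGeometry.Motives.specOver Ω Ω) ≫
      Functor.LaxMonoidal.ε (Over.pullback s) ≫ (Over.pullback s).map σ).left ≫ pullback.snd A.X.hom s =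
        𝟙 (Spec (.of Ω)) := by
    rw [Over.comp_left, Over.comp_left, Category.assoc, Category.assoc, hc', h23]
  ext : 1
  exact pullback.hom_ext ((A.restrictPt_left_fst s σ).trans hfst.symm)
    ((A.restrictPt_left_snd s σ).trans hsnd.symm)

/-- **Restriction to a fibre is multiplicative**: `(σ · τ)(s) = σ(s) · τ(s)` in `X_s(Ω)` — the base-change functor
`Over.pullback s` is cartesian-monoidal, so `(Over.pullback s).map` is a homomorphism for the transported group law
(Mathlib `Functor.map_mul`), and so is pre-composition (`MonObj.comp_mul`).
[cite: MumfordFogartyKirwan1994, Ch. 7 §1 Definition 7.1 (p. 129)] -/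
theorem restrictPt_mul (σ τ : A.Sections) :
    A.restrictPt s (σ * τ) = A.restrictPt s σ * A.restrictPt s τ := by
  simp only [restrictPt_eq_toUnit_comp_map]
  rw [Functor.map_mul, MonObj.comp_mul, MonObj.comp_mul]
  rfl

/-- The identity section restricts to the identity of `X_s(Ω)`: `1(s) = 1` (Mathlib `Functor.map_one`,
`MonObj.comp_one`). [cite: MumfordFogartyKirwan1994, Ch. 7 §1 Definition 7.1 (p. 129)] -/
@[simp]
theorem restrictPt_one : A.restrictPt s (1 : A.Sections) = 1 := by
  rw [restrictPt_eq_toUnit_comp_map, Functor.map_one, MonObj.comp_one, MonObj.comp_one]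
  rfl

/-- Restriction to a fibre commutes with inversion: `(σ⁻¹)(s) = σ(s)⁻¹` (Mathlib `Functor.map_inv'`,
`GrpObj.comp_inv`). [cite: MumfordFogartyKirwan1994, Ch. 7 §1 Definition 7.1 (p. 129)] -/
theorem restrictPt_inv (σ : A.Sections) : A.restrictPt s σ⁻¹ = (A.restrictPt s σ)⁻¹ := by
  simp only [restrictPt_eq_toUnit_comp_map]
  rw [Functor.map_inv', GrpObj.comp_inv, GrpObj.comp_inv]
  rfl

/-- Restriction to a fibre commutes with powers: `(σⁿ)(s) = σ(s)ⁿ` — the form in which the torsion clause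
`σᵢ ^ n = 1` of a level structure descends to `σᵢ(s) ∈ X_s[n](Ω)`.
[cite: MumfordFogartyKirwan1994, Ch. 7 §1 Definition 7.1 (p. 129)] -/
theorem restrictPt_pow (σ : A.Sections) (n : ℕ) : A.restrictPt s (σ ^ n) = A.restrictPt s σ ^ n := by
  induction n with
  | zero => rw [pow_zero, pow_zero, restrictPt_one]
  | succ n ih => rw [pow_succ, pow_succ, restrictPt_mul, ih]

/-- Restriction to a fibre commutes with integer powers. [cite: MumfordFogartyKirwan1994, Ch. 7 §1 Definition 7.1 (p. 129)] -/
theorem restrictPt_zpow (σ : A.Sections) (n : ℤ) : A.restrictPt s (σ ^ n) = A.restrictPt s σ ^ n := by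
  cases n with
  | ofNat n => rw [Int.ofNat_eq_natCast, zpow_natCast, zpow_natCast, restrictPt_pow]
  | negSucc n => rw [zpow_negSucc, zpow_negSucc, restrictPt_inv, restrictPt_pow]

/-- An `n`-torsion section restricts to an `n`-torsion point of every fibre: `σ ^ n = 1 ⇒ σ(s) ^ n = 1` (the
torsion clause `pow_σ` of a level structure read at a geometric point).
[cite: MumfordFogartyKirwan1994, Ch. 7 §1 Definition 7.1 (p. 129)] -/
theorem restrictPt_pow_eq_one {σ : A.Sections} {n : ℕ} (h : σ ^ n = 1) : A.restrictPt s σ ^ n = 1 := by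
  rw [← restrictPt_pow, h, restrictPt_one]

/-- Restriction to a fibre of an (ordered) product of sections is the product of the restrictions.
[cite: MumfordFogartyKirwan1994, Ch. 7 §1 Definition 7.1 (p. 129)] -/
theorem restrictPt_list_prod (l : List A.Sections) :
    A.restrictPt s l.prod = (l.map (A.restrictPt s)).prod := by
  induction l with
  | nil => rw [List.prod_nil, List.map_nil, List.prod_nil, restrictPt_one]
  | cons σ l ih => rw [List.prod_cons, List.map_cons, List.prod_cons, restrictPt_mul, ih]

/-- **Mumford's `Σ aᵢ σᵢ(s)`**: the restriction of the section `σ^a = ∏ᵢ σ(inl i)^{a(inl i)} · ∏ᵢ σ(inr i)^{a(inr i)}`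
to the fibre over `s` is the same ordered product of the points `σⱼ(s)` — the shape in which the basis clauses of a
level-`n` structure (`LevelStructure.basis_injective/_surjective`) are read in `X_s[n](Ω)`.
[cite: MumfordFogartyKirwan1994, Ch. 7 §1 Definition 7.1 (p. 129)] -/
theorem restrictPt_sectionPow {g n : ℕ} (σ : Fin g ⊕ Fin g → A.Sections) (a : Fin g ⊕ Fin g → ZMod n) :
    A.restrictPt s (A.sectionPow σ a) =
      (List.ofFn fun i : Fin g => A.restrictPt s (σ (Sum.inl i)) ^ (a (Sum.inl i)).val).prod *
        (List.ofFn fun i : Fin g => A.restrictPt s (σ (Sum.inr i)) ^ (a (Sum.inr i)).val).prod := by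
  rw [sectionPow, restrictPt_mul, restrictPt_list_prod, restrictPt_list_prod, List.map_ofFn, List.map_ofFn]
  simp only [Function.comp_def, restrictPt_pow]

/-- **Dictionary with the `FibrePoints` currency**: two sections have the same `Ω`-point `σ(s) = τ(s)` of
`A ×_S Spec Ω` iff they have the same restriction `restrict s σ = restrict s τ : Over.mk s ⟶ A.X` — both say
`s ≫ σ = s ≫ τ` (so the `basis_injective` clause of a level structure transfers verbatim between the two currencies).
[cite: MumfordFogartyKirwan1994, Ch. 7 §1 Definition 7.1 (p. 129)] -/
theorem restrictPt_eq_restrictPt_iff (σ τ : A.Sections) :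
    A.restrictPt s σ = A.restrictPt s τ ↔ A.restrict s σ = A.restrict s τ := by
  constructor
  · intro h
    ext : 1
    rw [restrict_left, restrict_left, ← A.restrictPt_left_fst s σ, ← A.restrictPt_left_fst s τ, h]
  · intro h
    have h' : s ≫ σ.left = s ≫ τ.left := congrArg (fun f => f.left) h
    ext : 1
    rw [restrictPt_left, restrictPt_left]
    simp only [h']

end AbelianSchemeOver

end Literature.AlgebraicGeometry.AbelianSchemes

end
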